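import Literature.Barriers.CriticalPhenomena.PlaquetteWalkAngleLimitAntipodeCriterion
import Literature.Barriers.CriticalPhenomena.PlaquetteWalkHoleRootHoleColumnAdjacentLaw
import Literature.Barriers.CriticalPhenomena.PlaquetteWalkHoleRootLevelFiveClasses
import HarnessLib

/-!
# Barrier catalogue (SAWScalingLimit): the ANTIPODE-FREE CRITERION for the printed vertex functional WEST of the root column, and its form NEXT TO THE HOLE
where only the class-`B2b` phases remain to be supplied («VF ≢ 0 NEXT TO THE HOLE, MODULO THE EXTENSIONS»)

`Z → ∞` limit model of the printed Yang–Baxter weights [GlazmanManolescu2019, §1, eq. (1)]; the «RECTANGLE COEFFICIENT» line (b-engine-1 g29). West of the root column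
the cleared vertex functional `P = (Z²·Den)^K · VF_D(a, f₀; ·)` starts at level `7` (`ybVFPoly_coeff_eq_woundLimitCoeff_seven_west`: `Λ₅ = 0`, the coefficient of
`Z^{4K−6}` is `Λ₇`), so `VF ≢ 0` there as soon as `Λ₇ ≠ 0`. With the ANTIPODE-FREE CRITERION (`PlaquetteWalkAngleLimitAntipodeCriterion`):

* ★★★ `vertexFunctional_printed_zero_set_finite_of_mem_phases_seven_west_above` / `_below` — at a rooted rhombus `f₀` west of the root column: if every level-`7` wound
  group member (class-`B2a` of cost `7`, or the cost-`7` extension of an `NS` member) has `limitWeight ∈ {cζ⁴, cζ⁸, cζ¹⁶, cζ²⁸}` (resp. `{c, cζ⁸, cζ²⁰, cζ²⁸}`) for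
  one `c ≠ 0`, and one member exists, then the zero set of `θ ↦ VF_{Dl}(w.side W, f₀; θ)` in `(0, π)` is FINITE, with at most `4·maxExp − 6` elements;
* ★★★★ `vertexFunctional_printed_zero_set_finite_holeColumn_adjacent_above` / `_below` — at `r = (w.1 − 1, w.2 ± 1)`, the class-`B2a` half of that hypothesis is
  the theorem `ΩG.limitWeight_mem_of_cost_seven_holeColumn_adjacent_above/_below` (`c = (√2)⁷`); what is left as a HYPOTHESIS is the class-`B2b` half — every
  cost-`7` extension `ext₃ ω` of a wound `NS` member at `r` has `limitWeight ∈ {(√2)⁷ζ⁴, (√2)⁷ζ⁸, (√2)⁷ζ¹⁶, (√2)⁷ζ²⁸}` (resp. the below set) — together with the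
  existence of one member. The lane census (kit j298353; 449 + 448 cells) has both: the extensions' phases are `k ∈ {2,4,7}` / `{2,5,7}` and every cell has members.

[GlazmanManolescu2019 §1 eq. (1), Lemma 2.1 (proof: the groups), Remark 2.2; Glazman2015WeightedSAW Lemma 3.1 (proof); the `Z → ∞` bookkeeping is lane plumbing.]
-/

noncomputable section

open private IsNS from Literature.Probability.RandomPlanarGeometry.YangBaxterSAWGeneralDomain

namespace Literature.Barriers.CriticalPhenomena.PlaquetteWalk

open Literature.Probability.RandomPlanarGeometry.SAW.YangBaxter
open Real Complex

section West

variable (Dl : List Face)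

open Classical in
/-- ★★★ **THE ANTIPODE-FREE CRITERION FOR `VF` WEST OF THE ROOT COLUMN (phases above the hole).** For a `W`-normalised hole root (hole `(w.1 − 1, w.2)` absent) and a
rooted rhombus `f₀` with `f₀.1 < w.1`: if every level-`7` wound group member at `f₀` has `limitWeight ∈ {cζ⁴, cζ⁸, cζ¹⁶, cζ²⁸}` for one `c ≠ 0` and one member
exists, then `{θ ∈ (0, π) : VF_{Dl}(w.side W, f₀; θ) = 0}` is finite with at most `4·maxExp − 6` elements.
[cite: GlazmanManolescu2019, Lemma 2.1 (proof: the groups) and eq. (1); Remark 2.2] [cite: Glazman2015WeightedSAW, Lemma 3.1 (proof, pp. 6–7)] -/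
theorem vertexFunctional_printed_zero_set_finite_of_mem_phases_seven_west_above {w f₀ : Face} (hh : holeFaceW w ∉ dom Dl)
    (hr : RootedFace (dom Dl) (w.side .W) f₀) (hwest : f₀.1 < w.1) {c : ℂ} (hc : c ≠ 0)
    (hall : ∀ ω ∈ (ΩG.setB2a (dom Dl) (w.side .W) f₀).filter (fun ω => ¬ω.Unwound hr),
      (cost (slotOfSide ω.1) ω.2.mids = 7 →
        (limitWeight (slotOfSide ω.1) ω.2.mids = c * zeta32 ^ 4 ∨ limitWeight (slotOfSide ω.1) ω.2.mids = c * zeta32 ^ 8 ∨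
          limitWeight (slotOfSide ω.1) ω.2.mids = c * zeta32 ^ 16 ∨ limitWeight (slotOfSide ω.1) ω.2.mids = c * zeta32 ^ 28)) ∧
      (IsNS ω hr → cost (slotOfSide (ω.ext₃ hr).1) (ω.ext₃ hr).2.mids = 7 →
        (limitWeight (slotOfSide (ω.ext₃ hr).1) (ω.ext₃ hr).2.mids = c * zeta32 ^ 4 ∨
          limitWeight (slotOfSide (ω.ext₃ hr).1) (ω.ext₃ hr).2.mids = c * zeta32 ^ 8 ∨
          limitWeight (slotOfSide (ω.ext₃ hr).1) (ω.ext₃ hr).2.mids = c * zeta32 ^ 16 ∨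
          limitWeight (slotOfSide (ω.ext₃ hr).1) (ω.ext₃ hr).2.mids = c * zeta32 ^ 28)))
    (hex : ∃ ω ∈ (ΩG.setB2a (dom Dl) (w.side .W) f₀).filter (fun ω => ¬ω.Unwound hr),
      cost (slotOfSide ω.1) ω.2.mids = 7 ∨ (IsNS ω hr ∧ cost (slotOfSide (ω.ext₃ hr).1) (ω.ext₃ hr).2.mids = 7)) :
    {θ ∈ Set.Ioo 0 π | vertexFunctional (printedWeights θ) tFiveEighths (ybCoeff θ) Dl (w.side .W) f₀ = 0}.Finite ∧
      {θ ∈ Set.Ioo 0 π | vertexFunctional (printedWeights θ) tFiveEighths (ybCoeff θ) Dl (w.side .W) f₀ = 0}.ncard ≤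
        4 * maxExp Dl (w.side .W) f₀ + 1 - 7 := by
  have hsum := woundLimitSum_ne_zero_of_mem_phases_above Dl (w.side .W) f₀ hr 7 hc hall hex
  have hcoef : woundLimitCoeff Dl (w.side .W) f₀ hr (maxExp Dl (w.side .W) f₀) 7 ≠ 0 :=
    (woundLimitCoeff_ne_zero_iff Dl (w.side .W) f₀ hr le_rfl 7).2 hsum
  exact vertexFunctional_printed_zero_set_finite_of_woundLimitCoeff_ne_zero Dl (w.side .W) f₀ hr le_rfl
    (woundCostGE_seven_west Dl hh hr hwest) hcoef

open Classical in
/-- ★★★ **THE ANTIPODE-FREE CRITERION FOR `VF` WEST OF THE ROOT COLUMN (phases below the hole)**: the same with the phase set `{c, cζ⁸, cζ²⁰, cζ²⁸}`.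
[cite: GlazmanManolescu2019, Lemma 2.1 (proof: the groups) and eq. (1); Remark 2.2] [cite: Glazman2015WeightedSAW, Lemma 3.1 (proof, pp. 6–7)] -/
theorem vertexFunctional_printed_zero_set_finite_of_mem_phases_seven_west_below {w f₀ : Face} (hh : holeFaceW w ∉ dom Dl)
    (hr : RootedFace (dom Dl) (w.side .W) f₀) (hwest : f₀.1 < w.1) {c : ℂ} (hc : c ≠ 0)
    (hall : ∀ ω ∈ (ΩG.setB2a (dom Dl) (w.side .W) f₀).filter (fun ω => ¬ω.Unwound hr),
      (cost (slotOfSide ω.1) ω.2.mids = 7 →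
        (limitWeight (slotOfSide ω.1) ω.2.mids = c ∨ limitWeight (slotOfSide ω.1) ω.2.mids = c * zeta32 ^ 8 ∨
          limitWeight (slotOfSide ω.1) ω.2.mids = c * zeta32 ^ 20 ∨ limitWeight (slotOfSide ω.1) ω.2.mids = c * zeta32 ^ 28)) ∧
      (IsNS ω hr → cost (slotOfSide (ω.ext₃ hr).1) (ω.ext₃ hr).2.mids = 7 →
        (limitWeight (slotOfSide (ω.ext₃ hr).1) (ω.ext₃ hr).2.mids = c ∨
          limitWeight (slotOfSide (ω.ext₃ hr).1) (ω.ext₃ hr).2.mids = c * zeta32 ^ 8 ∨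
          limitWeight (slotOfSide (ω.ext₃ hr).1) (ω.ext₃ hr).2.mids = c * zeta32 ^ 20 ∨
          limitWeight (slotOfSide (ω.ext₃ hr).1) (ω.ext₃ hr).2.mids = c * zeta32 ^ 28)))
    (hex : ∃ ω ∈ (ΩG.setB2a (dom Dl) (w.side .W) f₀).filter (fun ω => ¬ω.Unwound hr),
      cost (slotOfSide ω.1) ω.2.mids = 7 ∨ (IsNS ω hr ∧ cost (slotOfSide (ω.ext₃ hr).1) (ω.ext₃ hr).2.mids = 7)) :
    {θ ∈ Set.Ioo 0 π | vertexFunctional (printedWeights θ) tFiveEighths (ybCoeff θ) Dl (w.side .W) f₀ = 0}.Finite ∧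
      {θ ∈ Set.Ioo 0 π | vertexFunctional (printedWeights θ) tFiveEighths (ybCoeff θ) Dl (w.side .W) f₀ = 0}.ncard ≤
        4 * maxExp Dl (w.side .W) f₀ + 1 - 7 := by
  have hsum := woundLimitSum_ne_zero_of_mem_phases_below Dl (w.side .W) f₀ hr 7 hc hall hex
  have hcoef : woundLimitCoeff Dl (w.side .W) f₀ hr (maxExp Dl (w.side .W) f₀) 7 ≠ 0 :=
    (woundLimitCoeff_ne_zero_iff Dl (w.side .W) f₀ hr le_rfl 7).2 hsum
  exact vertexFunctional_printed_zero_set_finite_of_woundLimitCoeff_ne_zero Dl (w.side .W) f₀ hr le_rfl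
    (woundCostGE_seven_west Dl hh hr hwest) hcoef

end West

/-! ## Next to the hole: only the extensions' phases are left -/

section Adjacent

variable (Dl : List Face)

open Classical in
/-- ★★★★ **`VF ≢ 0` AT `(w.1 − 1, w.2 + 1)` MODULO THE EXTENSIONS.** For a `W`-normalised hole root of `dom Dl` (hole absent) and the rooted rhombus `r = (w.1 − 1, w.2 + 1)`
just above the hole: if every cost-`7` extension `ext₃ ω` of a wound `NS` member at `r` has `limitWeight ∈ {(√2)⁷ζ⁴, (√2)⁷ζ⁸, (√2)⁷ζ¹⁶, (√2)⁷ζ²⁸}` and one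
level-`7` member exists, then the zero set of `θ ↦ VF_{Dl}(w.side W, r; θ)` in `(0, π)` is finite (at most `4·maxExp − 6` elements) — the class-`B2a` members are
covered by `ΩG.limitWeight_mem_of_cost_seven_holeColumn_adjacent_above`. [cite: GlazmanManolescu2019, Lemma 2.1 (proof: the groups) and eq. (1); Remark 2.2]
[cite: Glazman2015WeightedSAW, Lemma 3.1 (proof, pp. 6–7)] -/
theorem vertexFunctional_printed_zero_set_finite_holeColumn_adjacent_above {w r : Face} (hh : holeFaceW w ∉ dom Dl)
    (hr : RootedFace (dom Dl) (w.side .W) r) (hcol : r.1 = w.1 - 1) (hadj : r.2 = w.2 + 1)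
    (hB2b : ∀ ω ∈ (ΩG.setB2a (dom Dl) (w.side .W) r).filter (fun ω => ¬ω.Unwound hr),
      IsNS ω hr → cost (slotOfSide (ω.ext₃ hr).1) (ω.ext₃ hr).2.mids = 7 →
        (limitWeight (slotOfSide (ω.ext₃ hr).1) (ω.ext₃ hr).2.mids = ((Real.sqrt 2 : ℝ) : ℂ) ^ 7 * zeta32 ^ 4 ∨
          limitWeight (slotOfSide (ω.ext₃ hr).1) (ω.ext₃ hr).2.mids = ((Real.sqrt 2 : ℝ) : ℂ) ^ 7 * zeta32 ^ 8 ∨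
          limitWeight (slotOfSide (ω.ext₃ hr).1) (ω.ext₃ hr).2.mids = ((Real.sqrt 2 : ℝ) : ℂ) ^ 7 * zeta32 ^ 16 ∨
          limitWeight (slotOfSide (ω.ext₃ hr).1) (ω.ext₃ hr).2.mids = ((Real.sqrt 2 : ℝ) : ℂ) ^ 7 * zeta32 ^ 28))
    (hex : ∃ ω ∈ (ΩG.setB2a (dom Dl) (w.side .W) r).filter (fun ω => ¬ω.Unwound hr),
      cost (slotOfSide ω.1) ω.2.mids = 7 ∨ (IsNS ω hr ∧ cost (slotOfSide (ω.ext₃ hr).1) (ω.ext₃ hr).2.mids = 7)) :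
    {θ ∈ Set.Ioo 0 π | vertexFunctional (printedWeights θ) tFiveEighths (ybCoeff θ) Dl (w.side .W) r = 0}.Finite ∧
      {θ ∈ Set.Ioo 0 π | vertexFunctional (printedWeights θ) tFiveEighths (ybCoeff θ) Dl (w.side .W) r = 0}.ncard ≤
        4 * maxExp Dl (w.side .W) r + 1 - 7 := by
  refine vertexFunctional_printed_zero_set_finite_of_mem_phases_seven_west_above Dl hh hr (by omega) sqrt_two_pow_seven_ne_zero
    (fun ω hω => ⟨fun hc => ?_, hB2b ω hω⟩) hex
  rw [Finset.mem_filter, ΩG.unwound_iff_AJ_root_eq_zero] at hω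
  obtain ⟨-, hU⟩ := hω
  push Not at hU
  obtain ⟨h, hA⟩ := hU
  rcases (ΩG.limitWeight_mem_of_cost_seven_holeColumn_adjacent_above hh hr h hA hc hcol hadj).1 with e | e | e
  · exact Or.inr (Or.inr (Or.inr e))
  · exact Or.inr (Or.inl e)
  · exact Or.inr (Or.inr (Or.inl e))

open Classical in
/-- ★★★★ **`VF ≢ 0` AT `(w.1 − 1, w.2 − 1)` MODULO THE EXTENSIONS**: the same just below the hole, with the phase set `{(√2)⁷, (√2)⁷ζ⁸, (√2)⁷ζ²⁰, (√2)⁷ζ²⁸}` for the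
extensions and `ΩG.limitWeight_mem_of_cost_seven_holeColumn_adjacent_below` for the class-`B2a` members. [cite: GlazmanManolescu2019, Lemma 2.1 (proof: the groups) and
eq. (1); Remark 2.2; §4.2 (lattice symmetries)] [cite: Glazman2015WeightedSAW, Lemma 3.1 (proof, pp. 6–7)] -/
theorem vertexFunctional_printed_zero_set_finite_holeColumn_adjacent_below {w r : Face} (hh : holeFaceW w ∉ dom Dl)
    (hr : RootedFace (dom Dl) (w.side .W) r) (hcol : r.1 = w.1 - 1) (hadj : r.2 = w.2 - 1)
    (hB2b : ∀ ω ∈ (ΩG.setB2a (dom Dl) (w.side .W) r).filter (fun ω => ¬ω.Unwound hr),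
      IsNS ω hr → cost (slotOfSide (ω.ext₃ hr).1) (ω.ext₃ hr).2.mids = 7 →
        (limitWeight (slotOfSide (ω.ext₃ hr).1) (ω.ext₃ hr).2.mids = ((Real.sqrt 2 : ℝ) : ℂ) ^ 7 ∨
          limitWeight (slotOfSide (ω.ext₃ hr).1) (ω.ext₃ hr).2.mids = ((Real.sqrt 2 : ℝ) : ℂ) ^ 7 * zeta32 ^ 8 ∨
          limitWeight (slotOfSide (ω.ext₃ hr).1) (ω.ext₃ hr).2.mids = ((Real.sqrt 2 : ℝ) : ℂ) ^ 7 * zeta32 ^ 20 ∨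
          limitWeight (slotOfSide (ω.ext₃ hr).1) (ω.ext₃ hr).2.mids = ((Real.sqrt 2 : ℝ) : ℂ) ^ 7 * zeta32 ^ 28))
    (hex : ∃ ω ∈ (ΩG.setB2a (dom Dl) (w.side .W) r).filter (fun ω => ¬ω.Unwound hr),
      cost (slotOfSide ω.1) ω.2.mids = 7 ∨ (IsNS ω hr ∧ cost (slotOfSide (ω.ext₃ hr).1) (ω.ext₃ hr).2.mids = 7)) :
    {θ ∈ Set.Ioo 0 π | vertexFunctional (printedWeights θ) tFiveEighths (ybCoeff θ) Dl (w.side .W) r = 0}.Finite ∧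
      {θ ∈ Set.Ioo 0 π | vertexFunctional (printedWeights θ) tFiveEighths (ybCoeff θ) Dl (w.side .W) r = 0}.ncard ≤
        4 * maxExp Dl (w.side .W) r + 1 - 7 := by
  refine vertexFunctional_printed_zero_set_finite_of_mem_phases_seven_west_below Dl hh hr (by omega) sqrt_two_pow_seven_ne_zero
    (fun ω hω => ⟨fun hc => ?_, hB2b ω hω⟩) hex
  rw [Finset.mem_filter, ΩG.unwound_iff_AJ_root_eq_zero] at hω
  obtain ⟨-, hU⟩ := hω
  push Not at hU
  obtain ⟨h, hA⟩ := hU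
  rcases (ΩG.limitWeight_mem_of_cost_seven_holeColumn_adjacent_below hh hr h hA hc hcol hadj).1 with e | e | e
  · exact Or.inr (Or.inl e)
  · exact Or.inr (Or.inr (Or.inr e))
  · exact Or.inr (Or.inr (Or.inl e))

end Adjacent

end Literature.Barriers.CriticalPhenomena.PlaquetteWalk
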